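import Mathlib
import Literature.MathematicalPhysics.QuantumFieldTheory.MagnenRivasseauSeneor1993.MRS93StartingAnsatz
import Literature.MathematicalPhysics.QuantumFieldTheory.MagnenRivasseauSeneor1993.MRS93MainStatementPinned
import HarnessLib

/-!
# Magnen–Rivasseau–Sénéor (CMP 155, 1993), §II.B p.335: the ANISOTROPIC momentum slices (II.21a)–(II.21b), the
# background cutoffs (II.22) and the slice decomposition of the field (II.23), typed AS PRINTED (with the one
# misprinted index flagged and its reading typed beside it)

statement-level skeleton of published definitions with citation tags; elementary API proved; nothing here is a claim
about the Yang–Mills mass gap, about continuum Yang–Mills on `T⁴` without infrared cutoff, or about the Clay problem —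
and nothing of Magnen–Rivasseau–Sénéor's analysis is asserted or formalised

**Citation header (reproduction of PUBLISHED work).** J. Magnen, V. Rivasseau, R. Sénéor, *Construction of YM₄ with
an infrared cutoff*, Commun. Math. Phys. **155** (1993) 325–383 [MagnenRivasseauSeneor1993], Sect. II.B «The Small
Field and Large Field Decomposition», pp. 334–335. Loci `p.NNN tl.nn` = journal page / text-layer line of the held
scan `paper:magnen1993-cmp155-mrs-ym4-infrared-cutoff` (PDF page = journal page − 324); the displays were read on the
decoded page images (renders of record `run/shared/lean/pub/lit-balaban/inprint/lit-balaban-p14/renders-cmp155/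
p11_full_s6.png`, and the crop `renders/p11_crop_r350-1500_s2.png` in the seat folder of unit
`pub-balaban-gaps-mrs-lit-1`, gen 2). Cell pub-balaban-gaps, track G3, seat mrs-lit-1; companion prose
`run/shared/lean/pub/pub-balaban-gaps/g3/MRS-AS-PRINTED.md` §2 (this file closes its row «(II.21a/b) — NOT typed»).
Builds on `…MRS93StartingAnsatz` (κ of (II.14), `scaledCutoff` κ_ρ (II.13), `sliceCutoff` κ^i (II.15),
`sum_sliceCutoff`, `lowIndex` N_i, `indexSet` 𝐏, `indexSet_lt_iff`) and on the pinned carrier of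
`…MRS93MainStatementPinned` (`MainStatement.Momentum`, `Mode`, `Config`).

**What the paper prints (verbatim, p.335 tl.2–19; p.334 tl.44–49 for 𝐏).**
* *«For every value of i = 1, …, ρ₁ we introduce an index α with integer values between N_i and i+1, where N_i is
  the integer part of i − |ln(λ_i^t)/ln M| (this rule seems obscure but is introduced because when |p| is of order
  M^i we want to decompose p₀ between λ_i M^i and M^{i+1}). The full set of ordered pairs (i, α) is called 𝐏 … we
  say that j′ = (i′, α′) < j = (i, α) iff i′ < i or i′ = i and α′ < α.»* (p.334 tl.44–49)
* *«For α ≠ N_i, and j = (i, α) we define κ^j(p) = κ^{i,α}(p, p₀) = κ^i(p)κ^{N_i}(p₀), (II.21a) and for α = N_i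
  we put κ^j = κ^{i,α}(p, p₀) = κ^i(p)κ_α(p₀). (II.21b) In this way we have allowed all values of p₀ down to
  p₀ = 0.»* (p.335 tl.2–6)
* *«We extend also formula (II.15) to pair of indices j = (i, α) by setting κ_j(p) = Σ_{j′<j} κ^{j′}(p), (II.22)
  and the frequencies appearing in (II.22) are called the low or background frequencies (relative to the pair
  j).»* (p.335 tl.7–11)
* *«We decompose the field in direct space as follows: A = Σ_𝐏 κ̃^{i,α} ∗ A ≡ Σ_{j∈𝐏} A^j (II.23) (where the
  tilde means the Fourier transform).»* (p.335 tl.12–15)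
* Later uses that fix the meaning: *«If we slice the propagator C_axial(p) according to the partition of unity
  given by the functions κ^j(p), we obtain pieces C^j_axial(p) ≡ κ^j(p)C_axial(p) which satisfy … C^j_axial(x − y)
  ≤ (K_q M^{2i}/λ)(1/(1 + |x₀ − y₀|M^α) · 1/(1 + |x⃗ − y⃗|M^i))^q, (II.27)»* (p.335 tl.34–38: the index `i` governs
  the spatial momentum scale `M^i`, the index `α` the time-momentum scale `M^α`); for the field `γ` *«we can also
  split in Fourier space γ as Σ_{i=0}^{ρ₂} γ^i(p), γ^i(p) ≡ κ^i(p)γ(p) (we do not need the anisotropic indices at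
  this stage because the homothetic gauge and the corresponding Fadeev-Popov formula that we are going to
  introduce are perfectly isotropic)»* (p.339 tl.25–28).

**The misprint, and how it is handled (nothing corrected silently).** In (II.21a) the right-hand side
`κ^i(p)κ^{N_i}(p₀)` does not depend on `α` AS PRINTED, so the family `(κ^{i,α})_{N_i ≤ α ≤ i+1}` printed
literally is NOT a partition of anything (all members with `α ≠ N_i` coincide — kernel-checked below,
`anisoSlicePrinted_indep`, `sum_anisoSlicePrinted`). The sentence that follows (II.21b) (*«In this way we have
allowed all values of p₀ down to p₀ = 0»*), the stated purpose of `α` (*«we want to decompose p₀ between λ_i M^i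
and M^{i+1}»*, p.334 tl.46–47), the words *«partition of unity given by the functions κ^j(p)»* (p.335 tl.34–35) and
the decay rate `M^α` in `x₀` of (II.27) all require the superscript to be `α`: `κ^{i,α}(p, p₀) = κ^i(p)κ^α(p₀)`
for `α ≠ N_i` (a SLICE of `p₀` at scale `M^α`), the bottom index `α = N_i` carrying the CUMULATIVE cutoff
`κ_{N_i}(p₀)` (all `|p₀| ≲ M^{N_i}`, down to `p₀ = 0`). Both are typed: `anisoSlicePrinted` (literal) and
`anisoSlice` (the reading), they AGREE at `α = N_i` ((II.21b) is unambiguous: `anisoSlicePrinted_eq_anisoSlice_of_eq`),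
and only the reading telescopes: **`sum_anisoSlice`** `Σ_{α=N_i}^{i+1} κ^{i,α}(p, p₀) = κ^i(p) κ_{i+1}(p₀)`, hence
`= κ^i(p)` whenever `|p₀| ≤ M^{i+1}` (`sum_anisoSlice_of_le`) — the partition of the isotropic slice `κ^i` into
time-momentum slices that (II.23) and (II.27) use. Everything downstream ((II.22), (II.23)) is typed over the
READING and says so in its docstring; the companion prose records the misprint (MRS-AS-PRINTED.md §2, row (II.21)).

**What is typed here (definitions with bodies; elementary API kernel-checked, zero `sorry`, zero named facts).**
* §1 `anisoSlicePrinted`, `anisoSlice P η M N i α r r₀` — (II.21a/b) as functions of `r = |p|` and `r₀ = |p₀|`,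
  the bottom index `N = N_i` a parameter (insert `lowIndex` of `…MRS93StartingAnsatz`, see §3); agreement at
  `α = N`, `α`-independence of the literal print, the telescoping identities, the values at `p₀ = 0`
  (`anisoSlice_bottom_at_zero`: the bottom block carries `κ^i(p)` in full; `anisoSlice_at_zero_of_ne`: every other
  block vanishes — *«allowed all values of p₀ down to p₀ = 0»*), and the bounds `0 ≤ κ^{i,α} ≤ κ^i ≤ 1`.
* §2 the GLOBAL partition: under `|p₀| ≤ |p|` (automatic for a 4-momentum) and `3 + η⁻¹ ≤ M` (so that the support
  `|p| < (3 + η⁻¹)M^i` of `κ^i`, `…StartingAnsatz.sliceCutoff_succ_eq_zero_of_ge`, lies below `M^{i+1}`),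
  `Σ_{α=N_i}^{i+1} κ^{i,α}(p, p₀) = κ^i(p)` for every `i ≥ 1` (`sum_anisoSlice_eq_sliceCutoff`). The hypothesis
  `3 + η⁻¹ ≤ M` is OURS and declared: the print takes «M an integer» (p.335 tl.18) and «η a small constant» (p.331
  tl.9) and does not compare them; without it the sum is `κ^i(p)κ_{i+1}(p₀)`, which differs from `κ^i(p)` exactly on
  the momenta `M^{i+1} < |p₀| ≤ |p| < (3 + η⁻¹)M^i`.
* §3 the index set as a FINITE set `indexFinset N ρ₁ ⊆ ℕ × ℕ` (pairs `(i, α)`, `1 ≤ i ≤ ρ₁`, `N i ≤ α ≤ i + 1`) with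
  `mem_indexFinset_iff`, and its agreement with the `Set (ℕ × ℤ)` of `…StartingAnsatz.indexSet` when the printed
  `N_i = lowIndex M (λ_i^t) i` is nonnegative (`mem_indexFinset_iff_mem_indexSet`). READING declared: the slices are
  typed for natural indices `α, N_i ≥ 0`, i.e. time-momentum scales `M^α ≥ 1 =` the infrared (unit-torus) scale; for
  the values of `C` where `N_i < 0` the extra printed indices label scales BELOW the infrared cutoff, where the
  momentum lattice `ℤ⁴ ∖ {0}` has no `p₀` but `0` and (II.15) prints no slice `κ^α` (it defines `κ^i` for `i ≥ 0`
  only) — the print is silent there and so is this file.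
* §4 (II.22) `backgroundCutoff … N ρ₁ j r r₀ = κ_j = Σ_{j′ ∈ 𝐏, j′ < j} κ^{j′}` with the printed order («i′ < i or
  i′ = i and α′ < α» = `Prod.Lex`, `lexLT_iff_toLex_lt`); PROVED: `backgroundCutoff_nonneg`, monotonicity in `j`
  (`backgroundCutoff_mono`: a later pair sees more background), and the bound by the full sum over 𝐏.
* §5 (II.23) on the pinned carrier of `…MRS93MainStatementPinned`: the slice operator `sliceField N i α A` =
  `κ̃^{i,α} ∗ A` in momentum space (multiplication of the Fourier coefficient at momentum `p ∈ ℤ⁴ ∖ {0}` by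
  `κ^{i,α}(|p|, |p₀|)`, READING (iv) below), the printed finite sum `fieldDecomposition N ρ₁ A = Σ_{j∈𝐏} A^j`, and
  what it reproduces, PROVED: `fieldDecomposition_apply` / `fieldDecomposition_apply_eq_sum` (`= (Σ_{i=1}^{ρ₁}
  κ^i(|p|)κ_{i+1}(|p₀|)) · Ã(p)` mode-wise, exactly) and, under `3 + η⁻¹ ≤ M`, **`fieldDecomposition_eq`**
  `Σ_{j∈𝐏} A^j = (κ_{ρ₁} − κ₀)(|p|) · Ã(p)`: the
  printed sum over 𝐏 (whose scale index starts at `i = 1`, p.334 tl.44) returns the field cut off at the fake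
  cutoff `ρ₁` MINUS its unit-scale slice `κ⁰ = κ₀` of (II.15). Whether the unit slice is meant to be part of (II.23)
  the print does not say (for `γ` the analogous split runs from `i = 0`, p.339 tl.25–26); typed as printed, the
  difference exhibited, not resolved.

**Readings (declared).** (i)–(iii) as in `…MRS93StartingAnsatz` (natural scale indices; κ radial, typed on
`r = |p| ≥ 0`). (iv) In `κ^{i,α}(p, p₀) = κ^i(p)κ^α(p₀)` the first factor is READ as the isotropic slice of
(II.13)–(II.15) evaluated at the Euclidean length `|p|` of the 4-momentum (as in (II.13) and in *«slice the propagator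
C_axial(p) according to the partition of unity given by the functions κ^j(p)»*, p.335 tl.34–35), the second at
`|p₀|`; the print's «(p, p₀)» could also be read with `p` the spatial momentum — nothing below depends on the choice
except §5, where `|p₀| ≤ |p|` is used and holds for the 4-momentum reading. (v) `N i` (the bottom index) is a free
parameter `ℕ → ℕ` of §§1–5; the printed choice is `N i = ⌊i − |ln(λ_i^t)/ln M|⌋` (`…StartingAnsatz.lowIndex`), §3.

**What is NOT claimed or typed.** The convolution `κ̃^{i,α} ∗ A` in direct space and the anisotropic lattices
`𝐃_{i,α}` (typed in `…MRS93PhaseCells`); the propagator bound (II.27) and Lemma II.1 (typed as printed in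
`…MRS93LargeFieldSmallFactor`, seat mrs-lit-2); the small/large field expansion (II.25)–(II.35); any claim that the
misprint reading is the authors' (it is the only reading under which their next sentence and (II.27) hold, which is
all this file says); anything about Bałaban's lattice programme.
-/

noncomputable section

open Finset

namespace Literature.MathematicalPhysics.QuantumFieldTheory.MagnenRivasseauSeneor1993

namespace Ansatz

/-! ## §1 The anisotropic slices (II.21a)–(II.21b): literal print and reading -/

section aniso

variable (P : CutoffProfile) (η M : ℝ)

/-- (II.21a)–(II.21b) AS PRINTED: *«For α ≠ N_i … κ^{i,α}(p, p₀) = κ^i(p)κ^{N_i}(p₀), (II.21a) and for α = N_i …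
κ^{i,α}(p, p₀) = κ^i(p)κ_α(p₀). (II.21b)»* — as a function of `r = |p|`, `r₀ = |p₀|`, with bottom index `N = N_i`.
The superscript `N_i` in (II.21a) is reproduced literally (see `anisoSlice` for the reading and the module docstring
for why it is a misprint). [cite: MagnenRivasseauSeneor1993, (II.21a)–(II.21b) p.335] -/
def anisoSlicePrinted (N i α : ℕ) (r r₀ : ℝ) : ℝ :=
  sliceCutoff P η M i r * (if α = N then scaledCutoff P η M α r₀ else sliceCutoff P η M N r₀)

/-- (II.21a)–(II.21b), READING `κ^{i,α}(p, p₀) = κ^i(p)κ^α(p₀)` for `α ≠ N_i` (a time-momentum SLICE at scale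
`M^α`) and `= κ^i(p)κ_{N_i}(p₀)` for `α = N_i` (the cumulative bottom block, *«all values of p₀ down to p₀ = 0»*).
[cite: MagnenRivasseauSeneor1993, (II.21a)–(II.21b) p.335] -/
def anisoSlice (N i α : ℕ) (r r₀ : ℝ) : ℝ :=
  sliceCutoff P η M i r * (if α = N then scaledCutoff P η M α r₀ else sliceCutoff P η M α r₀)

/-- (II.21b), the bottom block: `κ^{i,N_i}(p, p₀) = κ^i(p)κ_{N_i}(p₀)`.
[cite: MagnenRivasseauSeneor1993, (II.21b) p.335] -/
theorem anisoSlice_of_eq (N i : ℕ) (r r₀ : ℝ) :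
    anisoSlice P η M N i N r r₀ = sliceCutoff P η M i r * scaledCutoff P η M N r₀ := by
  simp [anisoSlice]

/-- (II.21a), reading: `κ^{i,α}(p, p₀) = κ^i(p)κ^α(p₀)` for `α ≠ N_i`.
[cite: MagnenRivasseauSeneor1993, (II.21a) p.335] -/
theorem anisoSlice_of_ne {N α : ℕ} (h : α ≠ N) (i : ℕ) (r r₀ : ℝ) :
    anisoSlice P η M N i α r r₀ = sliceCutoff P η M i r * sliceCutoff P η M α r₀ := by
  simp [anisoSlice, h]

/-- (II.21a) literally: `κ^{i,α}(p, p₀) = κ^i(p)κ^{N_i}(p₀)` for `α ≠ N_i`.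
[cite: MagnenRivasseauSeneor1993, (II.21a) p.335] -/
theorem anisoSlicePrinted_of_ne {N α : ℕ} (h : α ≠ N) (i : ℕ) (r r₀ : ℝ) :
    anisoSlicePrinted P η M N i α r r₀ = sliceCutoff P η M i r * sliceCutoff P η M N r₀ := by
  simp [anisoSlicePrinted, h]

/-- (II.21b) is unambiguous: at `α = N_i` the literal print and the reading coincide.
[cite: MagnenRivasseauSeneor1993, (II.21b) p.335] -/
theorem anisoSlicePrinted_eq_anisoSlice_of_eq (N i : ℕ) (r r₀ : ℝ) :
    anisoSlicePrinted P η M N i N r r₀ = anisoSlice P η M N i N r r₀ := by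
  simp [anisoSlicePrinted, anisoSlice]

/-- THE MISPRINT, kernel-checked: the literal right-hand side of (II.21a) does not depend on `α` (all blocks with
`α ≠ N_i` are the same function). [cite: MagnenRivasseauSeneor1993, (II.21a) p.335] -/
theorem anisoSlicePrinted_indep {N α α' : ℕ} (hα : α ≠ N) (hα' : α' ≠ N) (i : ℕ) (r r₀ : ℝ) :
    anisoSlicePrinted P η M N i α r r₀ = anisoSlicePrinted P η M N i α' r r₀ := by
  rw [anisoSlicePrinted_of_ne P η M hα, anisoSlicePrinted_of_ne P η M hα']

/-- Time-momentum telescoping: the cumulative bottom block plus the slices above it rebuild the cumulative cutoff,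
`κ_N(p₀) + Σ_{α=N+1}^{n} κ^α(p₀) = κ_n(p₀)` (from (II.15)). [cite: MagnenRivasseauSeneor1993, (II.15) p.331 and (II.21) p.335] -/
theorem scaledCutoff_add_sum_Ioc {N n : ℕ} (h : N ≤ n) (r₀ : ℝ) :
    scaledCutoff P η M N r₀ + ∑ α ∈ Ioc N n, sliceCutoff P η M α r₀ = scaledCutoff P η M n r₀ := by
  induction n, h using Nat.le_induction with
  | base => simp
  | succ n hn ih =>
    rw [sum_Ioc_succ_top hn, ← add_assoc, ih, sliceCutoff_succ]
    ring

/-- **The reading telescopes**: `Σ_{α=N_i}^{i+1} κ^{i,α}(p, p₀) = κ^i(p) κ_{i+1}(p₀)` (`N_i ≤ i + 1`, which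
`…StartingAnsatz.lowIndex_le` guarantees for the printed `N_i`). [cite: MagnenRivasseauSeneor1993, (II.21a)–(II.21b) p.335] -/
theorem sum_anisoSlice {N i : ℕ} (hN : N ≤ i + 1) (r r₀ : ℝ) :
    ∑ α ∈ Icc N (i + 1), anisoSlice P η M N i α r r₀ =
      sliceCutoff P η M i r * scaledCutoff P η M (i + 1) r₀ := by
  rw [← Ioc_insert_left hN, sum_insert (fun h => by simp at h), anisoSlice_of_eq]
  have hrest : ∑ α ∈ Ioc N (i + 1), anisoSlice P η M N i α r r₀ =
      ∑ α ∈ Ioc N (i + 1), sliceCutoff P η M i r * sliceCutoff P η M α r₀ := by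
    refine sum_congr rfl fun α hα => ?_
    have hα' : α ≠ N := by
      have := (mem_Ioc.mp hα).1
      omega
    exact anisoSlice_of_ne P η M hα' i r r₀
  rw [hrest, ← mul_sum, ← mul_add, scaledCutoff_add_sum_Ioc P η M hN]

/-- Hence the reading is a partition of the isotropic slice on `|p₀| ≤ M^{i+1}`:
`Σ_{α=N_i}^{i+1} κ^{i,α}(p, p₀) = κ^i(p)` there (`κ_{i+1}(p₀) = 1`, `…StartingAnsatz.scaledCutoff_eq_one`).
[cite: MagnenRivasseauSeneor1993, (II.21a)–(II.21b) p.335 and (II.13)–(II.14) p.331] -/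
theorem sum_anisoSlice_of_le (hM : 0 < M) {N i : ℕ} (hN : N ≤ i + 1) (r : ℝ) {r₀ : ℝ}
    (hr₀ : r₀ ≤ M ^ (i + 1)) :
    ∑ α ∈ Icc N (i + 1), anisoSlice P η M N i α r r₀ = sliceCutoff P η M i r := by
  rw [sum_anisoSlice P η M hN, scaledCutoff_eq_one P η hM (i + 1) hr₀, mul_one]

/-- … whereas the literal print sums to `κ^i(p)(κ_{N_i}(p₀) + (i + 1 − N_i)κ^{N_i}(p₀))` — not a partition.
[cite: MagnenRivasseauSeneor1993, (II.21a)–(II.21b) p.335] -/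
theorem sum_anisoSlicePrinted {N i : ℕ} (hN : N ≤ i + 1) (r r₀ : ℝ) :
    ∑ α ∈ Icc N (i + 1), anisoSlicePrinted P η M N i α r r₀ =
      sliceCutoff P η M i r * (scaledCutoff P η M N r₀ + ((i + 1 - N : ℕ) : ℝ) * sliceCutoff P η M N r₀) := by
  rw [← Ioc_insert_left hN, sum_insert (fun h => by simp at h)]
  have hrest : ∑ α ∈ Ioc N (i + 1), anisoSlicePrinted P η M N i α r r₀ =
      ∑ α ∈ Ioc N (i + 1), sliceCutoff P η M i r * sliceCutoff P η M N r₀ := by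
    refine sum_congr rfl fun α hα => ?_
    have hα' : α ≠ N := by
      have := (mem_Ioc.mp hα).1
      omega
    exact anisoSlicePrinted_of_ne P η M hα' i r r₀
  rw [hrest, sum_const, Nat.card_Ioc, nsmul_eq_mul]
  simp [anisoSlicePrinted]
  ring

/-- *«In this way we have allowed all values of p₀ down to p₀ = 0»*: at `p₀ = 0` the bottom block carries the
isotropic slice in full, `κ^{i,N_i}(p, 0) = κ^i(p)` (`M > 0`). [cite: MagnenRivasseauSeneor1993, p.335 tl.6] -/
theorem anisoSlice_bottom_at_zero (hM : 0 < M) (N i : ℕ) (r : ℝ) :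
    anisoSlice P η M N i N r 0 = sliceCutoff P η M i r := by
  rw [anisoSlice_of_eq, scaledCutoff_eq_one P η hM N (pow_pos hM N).le, mul_one]

/-- … and every other block vanishes at `p₀ = 0` (`α ≠ N_i`, `α ≥ 1`, `M ≥ 1`: the slice `κ^α` is supported away
from `0`). [cite: MagnenRivasseauSeneor1993, p.335 tl.6 and (II.15) p.331] -/
theorem anisoSlice_at_zero_of_ne (hM : 1 ≤ M) {N α : ℕ} (h : α ≠ N) (hα : 1 ≤ α) (i : ℕ) (r : ℝ) :
    anisoSlice P η M N i α r 0 = 0 := by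
  obtain ⟨k, rfl⟩ : ∃ k, α = k + 1 := ⟨α - 1, by omega⟩
  rw [anisoSlice_of_ne P η M h, sliceCutoff_succ_eq_zero_of_le P η M hM k (pow_pos (by linarith) k).le,
    mul_zero]

/-- `κ^{i,α} ≥ 0` (`η > 0`, `M ≥ 1`, `|p|, |p₀| ≥ 0`). [cite: MagnenRivasseauSeneor1993, (II.21a)–(II.21b) p.335] -/
theorem anisoSlice_nonneg (hη : 0 < η) (hM : 1 ≤ M) (N i α : ℕ) {r r₀ : ℝ} (hr : 0 ≤ r) (hr₀ : 0 ≤ r₀) :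
    0 ≤ anisoSlice P η M N i α r r₀ := by
  unfold anisoSlice
  refine mul_nonneg (sliceCutoff_nonneg P η M hη hM i hr) ?_
  split_ifs
  · exact (scaledCutoff_mem_Icc P η M α r₀).1
  · exact sliceCutoff_nonneg P η M hη hM α hr₀

/-- `κ^{i,α}(p, p₀) ≤ κ^i(p)`: each anisotropic block is a piece of the isotropic slice (`η > 0`, `M ≥ 1`,
`|p| ≥ 0`; any `p₀`). [cite: MagnenRivasseauSeneor1993, (II.21a)–(II.21b) p.335] -/
theorem anisoSlice_le_sliceCutoff (hη : 0 < η) (hM : 1 ≤ M) (N i α : ℕ) {r : ℝ} (hr : 0 ≤ r)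
    (r₀ : ℝ) : anisoSlice P η M N i α r r₀ ≤ sliceCutoff P η M i r := by
  unfold anisoSlice
  have h1 : (if α = N then scaledCutoff P η M α r₀ else sliceCutoff P η M α r₀) ≤ 1 := by
    split_ifs
    · exact (scaledCutoff_mem_Icc P η M α r₀).2
    · exact sliceCutoff_le_one P η M α r₀
  calc sliceCutoff P η M i r * (if α = N then scaledCutoff P η M α r₀ else sliceCutoff P η M α r₀)
      ≤ sliceCutoff P η M i r * 1 :=
        mul_le_mul_of_nonneg_left h1 (sliceCutoff_nonneg P η M hη hM i hr)
    _ = sliceCutoff P η M i r := mul_one _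

/-- `κ^{i,α} ≤ 1`. [cite: MagnenRivasseauSeneor1993, (II.21a)–(II.21b) p.335] -/
theorem anisoSlice_le_one (hη : 0 < η) (hM : 1 ≤ M) (N i α : ℕ) {r : ℝ} (hr : 0 ≤ r) (r₀ : ℝ) :
    anisoSlice P η M N i α r r₀ ≤ 1 :=
  (anisoSlice_le_sliceCutoff P η M hη hM N i α hr r₀).trans (sliceCutoff_le_one P η M i r)

/-! ## §2 The global partition of the isotropic slices (hypothesis `3 + η⁻¹ ≤ M`, ours, declared) -/

/-- If `3 + η⁻¹ ≤ M`, the support `|p| < (3 + η⁻¹)M^i` of the slice `κ^i` (`i ≥ 1`) lies below `M^{i+1}`, so for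
a 4-momentum (`|p₀| ≤ |p|`) the anisotropic blocks rebuild the isotropic slice exactly:
`Σ_{α=N_i}^{i+1} κ^{i,α}(p, p₀) = κ^i(p)`. [cite: MagnenRivasseauSeneor1993, (II.21a)–(II.21b) p.335 and Fig. II.1 p.331] -/
theorem sum_anisoSlice_eq_sliceCutoff (hη : 0 < η) (hηM : 3 + η⁻¹ ≤ M) {N i : ℕ} (hi : 1 ≤ i)
    (hN : N ≤ i + 1) {r r₀ : ℝ} (hr₀r : r₀ ≤ r) :
    ∑ α ∈ Icc N (i + 1), anisoSlice P η M N i α r r₀ = sliceCutoff P η M i r := by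
  have h3 : (3 : ℝ) < 3 + η⁻¹ := by have := inv_pos.mpr hη; linarith
  have hM1 : (1 : ℝ) ≤ M := by linarith
  have hM0 : (0 : ℝ) < M := by linarith
  rw [sum_anisoSlice P η M hN]
  obtain ⟨k, rfl⟩ : ∃ k, i = k + 1 := ⟨i - 1, by omega⟩
  rcases le_or_gt ((3 + η⁻¹) * M ^ (k + 1)) r with hbig | hsmall
  · rw [sliceCutoff_succ_eq_zero_of_ge P η M hη hM1 k hbig, zero_mul]
  · have hr₀' : r₀ ≤ M ^ (k + 1 + 1) := by
      have : (3 + η⁻¹) * M ^ (k + 1) ≤ M ^ (k + 1 + 1) := by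
        rw [pow_succ M (k + 1), mul_comm]
        exact mul_le_mul_of_nonneg_left hηM (pow_pos hM0 _).le
      linarith
    rw [scaledCutoff_eq_one P η hM0 (k + 1 + 1) hr₀', mul_one]

end aniso

/-! ## §3 The index set 𝐏 as a finite set of pairs of natural numbers -/

/-- 𝐏 = {(i, α) : 1 ≤ i ≤ ρ₁, N_i ≤ α ≤ i + 1} as a `Finset (ℕ × ℕ)`, the bottom indices given by `N : ℕ → ℕ`
(READING (v), §3 of the module docstring: natural indices). [cite: MagnenRivasseauSeneor1993, §II.B p.334 tl.44–47] -/
def indexFinset (N : ℕ → ℕ) (ρ₁ : ℕ) : Finset (ℕ × ℕ) :=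
  (Icc 1 ρ₁).biUnion fun i => (Icc (N i) (i + 1)).map ⟨fun α => (i, α), fun _ _ h => (Prod.mk.inj h).2⟩

/-- Membership in 𝐏, unfolded. [cite: MagnenRivasseauSeneor1993, §II.B p.334 tl.44–47] -/
theorem mem_indexFinset_iff (N : ℕ → ℕ) (ρ₁ i α : ℕ) :
    (i, α) ∈ indexFinset N ρ₁ ↔ 1 ≤ i ∧ i ≤ ρ₁ ∧ N i ≤ α ∧ α ≤ i + 1 := by
  simp only [indexFinset, mem_biUnion, mem_Icc, mem_map, Function.Embedding.coeFn_mk, Prod.mk.injEq]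
  constructor
  · rintro ⟨i', ⟨h1, h2⟩, α', ⟨h3, h4⟩, rfl, rfl⟩
    exact ⟨h1, h2, h3, h4⟩
  · rintro ⟨h1, h2, h3, h4⟩
    exact ⟨i, ⟨h1, h2⟩, α, ⟨h3, h4⟩, rfl, rfl⟩

/-- With the printed bottom index `N_i = ⌊i − |ln(λ_i^t)/ln M|⌋` (`…StartingAnsatz.lowIndex`), whenever it is
nonnegative the finite set of natural pairs IS the printed 𝐏 of `…StartingAnsatz.indexSet`.
[cite: MagnenRivasseauSeneor1993, §II.B p.334 tl.44–47] -/
theorem mem_indexFinset_iff_mem_indexSet (M : ℝ) (lam : ℕ → ℝ) (ρ₁ : ℕ)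
    (hN : ∀ i, 0 ≤ lowIndex M (lam i) i) (i α : ℕ) :
    (i, α) ∈ indexFinset (fun i => (lowIndex M (lam i) i).toNat) ρ₁ ↔ ((i, (α : ℤ)) ∈ indexSet M lam ρ₁) := by
  rw [mem_indexFinset_iff, mem_indexSet_iff]
  have h := hN i
  have e : ((lowIndex M (lam i) i).toNat : ℤ) = lowIndex M (lam i) i := Int.toNat_of_nonneg h
  constructor
  · rintro ⟨h1, h2, h3, h4⟩
    refine ⟨h1, h2, ?_, by exact_mod_cast h4⟩
    rw [← e]; exact_mod_cast h3
  · rintro ⟨h1, h2, h3, h4⟩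
    refine ⟨h1, h2, ?_, by exact_mod_cast h4⟩
    have : ((lowIndex M (lam i) i).toNat : ℤ) ≤ (α : ℤ) := by rw [e]; exact h3
    exact_mod_cast this

/-- The top pair `(i, i + 1)` of each scale lies in 𝐏 (`1 ≤ i ≤ ρ₁`, `N_i ≤ i + 1`).
[cite: MagnenRivasseauSeneor1993, §II.B p.334 tl.44–47] -/
theorem top_mem_indexFinset {N : ℕ → ℕ} {ρ₁ i : ℕ} (h1 : 1 ≤ i) (h2 : i ≤ ρ₁) (hN : N i ≤ i + 1) :
    (i, i + 1) ∈ indexFinset N ρ₁ :=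
  (mem_indexFinset_iff N ρ₁ i (i + 1)).mpr ⟨h1, h2, hN, le_rfl⟩

/-- The printed order on pairs, *«j′ = (i′, α′) < j = (i, α) iff i′ < i or i′ = i and α′ < α»* (p.334
tl.48–49), as a decidable predicate. [cite: MagnenRivasseauSeneor1993, §II.B p.334 tl.48–49] -/
def lexLT (j' j : ℕ × ℕ) : Prop := j'.1 < j.1 ∨ (j'.1 = j.1 ∧ j'.2 < j.2)

/-- The printed order is decidable (so that the sum «Σ_{j′<j}» of (II.22) is a `Finset.filter`).
[cite: MagnenRivasseauSeneor1993, §II.B p.334 tl.48–49] -/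
instance lexLT.decidable (j' j : ℕ × ℕ) : Decidable (lexLT j' j) := by unfold lexLT; infer_instance

/-- It IS the lexicographic order (`…StartingAnsatz.indexSet_lt_iff`). [cite: MagnenRivasseauSeneor1993, §II.B p.334 tl.48–49] -/
theorem lexLT_iff_toLex_lt (j' j : ℕ × ℕ) : lexLT j' j ↔ toLex j' < toLex j := by
  unfold lexLT
  rw [Prod.Lex.toLex_lt_toLex]

/-- The printed order is transitive. [cite: MagnenRivasseauSeneor1993, §II.B p.334 tl.48–49] -/
theorem lexLT_trans {a b c : ℕ × ℕ} (hab : lexLT a b) (hbc : lexLT b c) : lexLT a c := by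
  rw [lexLT_iff_toLex_lt] at *
  exact hab.trans hbc

/-! ## §4 (II.22) The background cutoffs `κ_j = Σ_{j′<j} κ^{j′}` -/

section background

variable (P : CutoffProfile) (η M : ℝ) (N : ℕ → ℕ) (ρ₁ : ℕ)

/-- (II.22): *«κ_j(p) = Σ_{j′<j} κ^{j′}(p)»* — the sum of the anisotropic slices (READING of (II.21a)) over the pairs
of 𝐏 that precede `j` in the printed order; *«the frequencies appearing in (II.22) are called the low or background
frequencies (relative to the pair j)»*. [cite: MagnenRivasseauSeneor1993, (II.22) p.335 tl.7–11] -/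
def backgroundCutoff (j : ℕ × ℕ) (r r₀ : ℝ) : ℝ :=
  ∑ j' ∈ (indexFinset N ρ₁).filter (fun j' => lexLT j' j), anisoSlice P η M (N j'.1) j'.1 j'.2 r r₀

/-- The full sum of the slices over 𝐏 (the multiplier of (II.23)). [cite: MagnenRivasseauSeneor1993, (II.23) p.335] -/
def totalCutoff (r r₀ : ℝ) : ℝ :=
  ∑ j' ∈ indexFinset N ρ₁, anisoSlice P η M (N j'.1) j'.1 j'.2 r r₀

/-- `κ_j ≥ 0` (`η > 0`, `M ≥ 1`, `|p|, |p₀| ≥ 0`). [cite: MagnenRivasseauSeneor1993, (II.22) p.335] -/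
theorem backgroundCutoff_nonneg (hη : 0 < η) (hM : 1 ≤ M) (j : ℕ × ℕ) {r r₀ : ℝ} (hr : 0 ≤ r)
    (hr₀ : 0 ≤ r₀) : 0 ≤ backgroundCutoff P η M N ρ₁ j r r₀ :=
  sum_nonneg fun _ _ => anisoSlice_nonneg P η M hη hM _ _ _ hr hr₀

/-- A later pair sees more background: `j ≤ j′` in the printed order implies `κ_j ≤ κ_{j′}` (the slices are
nonnegative). [cite: MagnenRivasseauSeneor1993, (II.22) p.335] -/
theorem backgroundCutoff_mono (hη : 0 < η) (hM : 1 ≤ M) {j k : ℕ × ℕ} (hjk : toLex j ≤ toLex k) {r r₀ : ℝ}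
    (hr : 0 ≤ r) (hr₀ : 0 ≤ r₀) :
    backgroundCutoff P η M N ρ₁ j r r₀ ≤ backgroundCutoff P η M N ρ₁ k r r₀ := by
  unfold backgroundCutoff
  refine sum_le_sum_of_subset_of_nonneg ?_ fun _ _ _ => anisoSlice_nonneg P η M hη hM _ _ _ hr hr₀
  intro j' hj'
  rw [mem_filter] at hj' ⊢
  refine ⟨hj'.1, ?_⟩
  rw [lexLT_iff_toLex_lt] at hj' ⊢
  exact lt_of_lt_of_le hj'.2 hjk

/-- The background cutoff is bounded by the full sum over 𝐏. [cite: MagnenRivasseauSeneor1993, (II.22)–(II.23) p.335] -/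
theorem backgroundCutoff_le_totalCutoff (hη : 0 < η) (hM : 1 ≤ M) (j : ℕ × ℕ) {r r₀ : ℝ} (hr : 0 ≤ r)
    (hr₀ : 0 ≤ r₀) : backgroundCutoff P η M N ρ₁ j r r₀ ≤ totalCutoff P η M N ρ₁ r r₀ :=
  sum_le_sum_of_subset_of_nonneg (filter_subset _ _)
    fun _ _ _ => anisoSlice_nonneg P η M hη hM _ _ _ hr hr₀

/-- The full sum over 𝐏, computed scale by scale with the telescoping of §1:
`Σ_{j∈𝐏} κ^j(p, p₀) = Σ_{i=1}^{ρ₁} κ^i(p) κ_{i+1}(p₀)` (bottom indices `N_i ≤ i + 1`).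
[cite: MagnenRivasseauSeneor1993, (II.21)–(II.23) p.335] -/
theorem totalCutoff_eq (hN : ∀ i, N i ≤ i + 1) (r r₀ : ℝ) :
    totalCutoff P η M N ρ₁ r r₀ =
      ∑ i ∈ Icc 1 ρ₁, sliceCutoff P η M i r * scaledCutoff P η M (i + 1) r₀ := by
  unfold totalCutoff indexFinset
  rw [sum_biUnion]
  · refine sum_congr rfl fun i _ => ?_
    rw [sum_map]
    exact sum_anisoSlice P η M (hN i) r r₀
  · intro i _ i' _ hii'
    simp only [Function.onFun]
    rw [disjoint_left]
    intro x hx hx'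
    rw [mem_map] at hx hx'
    obtain ⟨α, -, rfl⟩ := hx
    obtain ⟨α', -, h⟩ := hx'
    exact hii' (Prod.mk.inj h).1.symm

/-- Under `3 + η⁻¹ ≤ M` and `|p₀| ≤ |p|` the full sum over 𝐏 is the cutoff at the fake scale `ρ₁` minus the
unit-scale slice: `Σ_{j∈𝐏} κ^j(p, p₀) = κ_{ρ₁}(|p|) − κ₀(|p|)` (the scale index of 𝐏 starts at `i = 1`, p.334
tl.44). [cite: MagnenRivasseauSeneor1993, (II.21)–(II.23) p.335 and (II.15) p.331] -/
theorem totalCutoff_eq_sub (hη : 0 < η) (hηM : 3 + η⁻¹ ≤ M) (hN : ∀ i, N i ≤ i + 1) {r r₀ : ℝ}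
    (hr₀r : r₀ ≤ r) :
    totalCutoff P η M N ρ₁ r r₀ = scaledCutoff P η M ρ₁ r - scaledCutoff P η M 0 r := by
  rw [totalCutoff_eq P η M N ρ₁ hN]
  have h1 : ∑ i ∈ Icc 1 ρ₁, sliceCutoff P η M i r * scaledCutoff P η M (i + 1) r₀ =
      ∑ i ∈ Icc 1 ρ₁, sliceCutoff P η M i r := by
    refine sum_congr rfl fun i hi => ?_
    rw [← sum_anisoSlice P η M (hN i) r r₀]
    exact sum_anisoSlice_eq_sliceCutoff P η M hη hηM (mem_Icc.mp hi).1 (hN i) hr₀r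
  rw [h1]
  have h2 := sum_sliceCutoff P η M ρ₁ r
  rw [Finset.range_eq_Ico, sum_eq_sum_Ico_succ_bot (Nat.succ_pos ρ₁), sliceCutoff_zero] at h2
  have h3 : Finset.Ico 1 (ρ₁ + 1) = Icc 1 ρ₁ := rfl
  rw [h3] at h2
  linarith

end background

end Ansatz

/-! ## §5 (II.23) The slice decomposition of the field on the pinned carrier -/

namespace MainStatement

open Ansatz

/-- The Euclidean length `|p|` of a lattice momentum `p ∈ ℤ⁴ ∖ {0}` (READING (iv)).
[cite: MagnenRivasseauSeneor1993, (II.13) p.331 and §II.A p.328] -/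
def Momentum.norm (p : Momentum) : ℝ := Real.sqrt (∑ μ, ((p.1 μ : ℤ) : ℝ) ^ 2)

/-- The time-momentum size `|p₀|`. [cite: MagnenRivasseauSeneor1993, §II.A p.328 tl.19 and (II.21) p.335] -/
def Momentum.timeAbs (p : Momentum) : ℝ := |((p.1 0 : ℤ) : ℝ)|

/-- `0 ≤ |p|`. [cite: MagnenRivasseauSeneor1993, (II.13) p.331] -/
theorem Momentum.norm_nonneg (p : Momentum) : 0 ≤ p.norm := Real.sqrt_nonneg _

/-- `0 ≤ |p₀|`. [cite: MagnenRivasseauSeneor1993, (II.21) p.335] -/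
theorem Momentum.timeAbs_nonneg (p : Momentum) : 0 ≤ p.timeAbs := abs_nonneg _

/-- For a 4-momentum, `|p₀| ≤ |p|`. [cite: MagnenRivasseauSeneor1993, (II.21) p.335] -/
theorem Momentum.timeAbs_le_norm (p : Momentum) : p.timeAbs ≤ p.norm := by
  unfold Momentum.timeAbs Momentum.norm
  rw [← Real.sqrt_sq_eq_abs]
  refine Real.sqrt_le_sqrt ?_
  have : ((p.1 0 : ℤ) : ℝ) ^ 2 = ∑ μ ∈ ({0} : Finset (Fin 4)), ((p.1 μ : ℤ) : ℝ) ^ 2 := by simp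
  rw [this]
  exact sum_le_sum_of_subset_of_nonneg (subset_univ _) fun μ _ _ => sq_nonneg _

variable (par : Parameters) (N : ℕ → ℕ)

/-- (II.23), one block: `A^j = κ̃^{i,α} ∗ A`, i.e. in momentum space the Fourier coefficient at `p` multiplied by
`κ^{i,α}(|p|, |p₀|)` (READING of (II.21a); all Lorentz/colour/real-imaginary components alike), with the named
cutoff data `τ, η, M` of `par`. [cite: MagnenRivasseauSeneor1993, (II.23) p.335 tl.12–15] -/
def sliceField (i α : ℕ) (A : Config) : Config := fun m =>
  anisoSlice par.τ par.η par.M (N i) i α m.1.norm m.1.timeAbs * A m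

/-- (II.23) AS PRINTED: `Σ_{j∈𝐏} A^j`, the finite sum of the blocks over 𝐏 (scale index `1 ≤ i ≤ ρ₁`).
[cite: MagnenRivasseauSeneor1993, (II.23) p.335 tl.12–15] -/
def fieldDecomposition (ρ₁ : ℕ) (A : Config) : Config := fun m =>
  ∑ j ∈ indexFinset N ρ₁, sliceField par N j.1 j.2 A m

/-- Mode-wise, the printed sum multiplies the Fourier coefficient by the full sum of the slices over 𝐏.
[cite: MagnenRivasseauSeneor1993, (II.23) p.335] -/
theorem fieldDecomposition_apply (ρ₁ : ℕ) (A : Config) (m : Mode) :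
    fieldDecomposition par N ρ₁ A m = totalCutoff par.τ par.η par.M N ρ₁ m.1.norm m.1.timeAbs * A m := by
  unfold fieldDecomposition sliceField totalCutoff
  rw [sum_mul]

/-- … that is, by `Σ_{i=1}^{ρ₁} κ^i(|p|) κ_{i+1}(|p₀|)` exactly (bottom indices `N_i ≤ i + 1`).
[cite: MagnenRivasseauSeneor1993, (II.21)–(II.23) p.335] -/
theorem fieldDecomposition_apply_eq_sum (hN : ∀ i, N i ≤ i + 1) (ρ₁ : ℕ) (A : Config) (m : Mode) :
    fieldDecomposition par N ρ₁ A m =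
      (∑ i ∈ Icc 1 ρ₁, sliceCutoff par.τ par.η par.M i m.1.norm *
        scaledCutoff par.τ par.η par.M (i + 1) m.1.timeAbs) * A m := by
  rw [fieldDecomposition_apply, totalCutoff_eq _ _ _ N ρ₁ hN]

/-- **What (II.23) reproduces.** Under `3 + η⁻¹ ≤ M` the printed sum over 𝐏 returns, mode by mode, the field cut
off at the fake scale `ρ₁` MINUS its unit-scale slice `κ⁰ = κ₀` of (II.15):
`(Σ_{j∈𝐏} A^j)~(p) = (κ_{ρ₁}(|p|) − κ₀(|p|)) Ã(p)`. (The scale index of 𝐏 starts at `i = 1` as printed, p.334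
tl.44; whether the unit slice belongs to (II.23) the print does not say — exhibited, not resolved.)
[cite: MagnenRivasseauSeneor1993, (II.23) p.335, p.334 tl.44 and (II.15) p.331] -/
theorem fieldDecomposition_eq (hηM : 3 + par.η⁻¹ ≤ (par.M : ℝ)) (hN : ∀ i, N i ≤ i + 1) (ρ₁ : ℕ)
    (A : Config) (m : Mode) :
    fieldDecomposition par N ρ₁ A m =
      (par.uvCutoff ρ₁ m.1.norm - par.uvCutoff 0 m.1.norm) * A m := by
  rw [fieldDecomposition_apply,
    totalCutoff_eq_sub _ _ _ N ρ₁ par.hη hηM hN (Momentum.timeAbs_le_norm m.1)]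
  rfl

/-- Each block is bounded by the field, mode-wise: `|Ã^j(p)| ≤ |Ã(p)|` (`0 ≤ κ^{i,α} ≤ 1`).
[cite: MagnenRivasseauSeneor1993, (II.21)–(II.23) p.335] -/
theorem abs_sliceField_le (i α : ℕ) (A : Config) (m : Mode) : |sliceField par N i α A m| ≤ |A m| := by
  unfold sliceField
  have hM : (1 : ℝ) ≤ par.M := par.one_lt_M.le
  rw [abs_mul]
  have h0 := anisoSlice_nonneg par.τ par.η (par.M : ℝ) par.hη hM (N i) i α (Momentum.norm_nonneg m.1)
    (Momentum.timeAbs_nonneg m.1)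
  have h1 := anisoSlice_le_one par.τ par.η (par.M : ℝ) par.hη hM (N i) i α (Momentum.norm_nonneg m.1)
    m.1.timeAbs
  rw [abs_of_nonneg h0]
  calc _ ≤ 1 * |A m| := mul_le_mul_of_nonneg_right h1 (abs_nonneg _)
    _ = |A m| := one_mul _

end MainStatement

end Literature.MathematicalPhysics.QuantumFieldTheory.MagnenRivasseauSeneor1993
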